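import Mathlib.Analysis.Normed.Module.HahnBanach
import Summits.QuantumFields.BalabanUV.T4Continuum.Support.NE3LatticeGradientBarrier
import Summits.QuantumFields.BalabanUV.T4Continuum.Support.SkeletonLattice
import Summits.QuantumFields.BalabanUV.T4Continuum.Support.AveragingDeficitTorusChart
import HarnessLib

/-!
# T⁴ programme, node NE3 — census R37 (file 2∕3): THE LATTICE INTERIOR GRADIENT ESTIMATE (scalar and normed-space valued) AND ITS CONSEQUENCE —
# SUP-REGULARITY OF THE LATTICE LAPLACIAN ON BLOCK-MEAN-ZERO PERIODIC FIELDS, UNIFORM IN THE BLOCK SIZE AND THE VOLUME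

Cell `pub-balaban-gaps` (YM blitz, track G2, seat `ne3`, unit `pub-balaban-gaps-ne3-g8`; writer prover-pub-balaban-gaps-ne3-g8-0, 2026-08-24), census
`run/shared/lean/pub/pub-balaban-gaps/ne/NE3.md` §4 R37, §14.  Over file 1∕3 (`NE3LatticeGradientBarrier.sub_le_of_laplacian_aux`, the barrier comparison):

* §1 **`sub_le_of_laplacian_zero`**, **`abs_sub_le_of_laplacian`** — [Gilbarg–Trudinger Thm 3.9] on `ℤᵈ`: for `u : ℤᵈ → ℝ`, a site `x₀`, a direction `μ`
  and `R ≥ 1`, `|u(x₀ + e_μ) − u(x₀)| ≤ 2·(d·U∕R + R·B)` where `U`, `B` bound `|u|` and the lattice Laplacian `|Σ_i ((u(x+e_i) − u x) − (u x − u(x−e_i)))|`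
  on the sup-cube `{|x_i − x₀,i| ≤ R}` (`B′ ↓ B`, translation, `u ↦ −u`).
* §2 **`norm_sub_le_of_laplacian`** — the same for `u : ℤᵈ → E`, `E` any real normed space (scalar case on `g ∘ u` for a norming functional `g`, Hahn–Banach).
* §3 **`lipschitz_of_forwardDiff`** (forward differences `≤ G` ⟹ `G`-Lipschitz for the `ℓ¹` lattice distance) and **`supRegularity_of_blockMeanZero`**:
  for `d ≥ 1`, `M ≥ 1`, `N ≥ 1` and an `(N·M)`-periodic `u : ℤᵈ → E` whose `M`-block sums vanish and whose lattice Laplacian is bounded by `B` in norm,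
  `‖u(x+e_i) − u x‖ ≤ 16d²·M·B` and `‖u x‖ ≤ 16d³·M²·B` everywhere — UNIFORMLY in `N` and `M` (bootstrap: the block means give `‖u‖_∞ ≤ dM·G` for the
  maximal forward difference `G` over one period; §2 at the maximising bond with `R = 4d²M` gives `G ≤ G∕2 + 8d²MB`).

File 3∕3 (`Spine/NE3/LandauCorrectionSupB8FlatH0`) reads §3 on B8's test space `N(Q′(1)) = avgKernelGauges L N (j+1) 1` with `Δ_1 = covLapSite 1`, `D_1 = gaugeDir 1`:
(H0) at the flat datum for EVERY `(L, N, j)`, hence the flat-datum `hK` on the unit torus UNCONDITIONALLY and on every torus from (HR) alone.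

CONTENT ([folklore] lattice potential theory; 0 sorry; no `def`).  HONEST FRAMING.  Elementary lattice analysis at the TRIVIAL background; nothing about curved
backgrounds or Bałaban's minimisers; (HR) for `N ≥ 2`, `hK` over `sfClass`, (P♮) at curved `W`, the covariant root and **NE3 are NOT proved**; spine PROVED 0∕9;
finite T⁴ rung (B)+1 — NOT continuum YM on ℝ⁴, NOT infinite volume, NOT mass gap, NOT Clay.  PLACEMENT: `Summits/QuantumFields/BalabanUV/T4Continuum/Support/`.
-/

set_option autoImplicit false

open scoped BigOperators
open Finset

namespace Summit.QuantumFields.BalabanUV.T4Continuum.NE3DiscreteGradientEstimate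

open Literature.MathematicalPhysics.QuantumFieldTheory.Balaban1983to89
open B7Prop1Explicit
open T4AveragingDeficitWallBoundary (periodBox mem_periodBox card_periodBox)
open SkeletonLattice (cdiv cmod smul_cdiv_add_cmod cmod_nonneg cmod_lt)
open AveragingDeficitTorusChart (eq_sum_smul_e periodic_smul_vec)
open NE3LatticeGradientBarrier (sub_le_of_laplacian_aux)

noncomputable section

variable {d : ℕ}

/-! ## §1 The scalar interior gradient estimate -/

/-- **THE LATTICE INTERIOR GRADIENT ESTIMATE (scalar, one-sided, at the origin)**: `u(e_μ) − u(0) ≤ 2·(d·U∕R + R·B)` for `|u| ≤ U`, `|Δu| ≤ B` on the sup-cube of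
radius `R ≥ 1` about `0`. [folklore] -/
theorem sub_le_of_laplacian_zero (μ : Fin d) {R : ℕ} (hR : 1 ≤ R) (u : Site d → ℝ) {U B : ℝ}
    (hU : ∀ x : Site d, (∀ i, |x i| ≤ (R : ℤ)) → |u x| ≤ U)
    (hB : ∀ x : Site d, (∀ i, |x i| ≤ (R : ℤ)) → |∑ i, ((u (x + e i) - u x) - (u x - u (x - e i)))| ≤ B) :
    u (e μ) - u 0 ≤ 2 * ((d : ℝ) * U / R + R * B) := by
  have hR0 : (0 : ℝ) < R := by exact_mod_cast hR
  refine le_of_forall_pos_le_add fun ε hε => ?_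
  have hε' : 0 < ε / (2 * R) := by positivity
  have h := sub_le_of_laplacian_aux μ hR u (B' := B + ε / (2 * R)) (by linarith) hU hB
  have heq : 2 * ((d : ℝ) * U / R + R * (B + ε / (2 * R))) = 2 * ((d : ℝ) * U / R + R * B) + ε := by
    field_simp; ring
  linarith

/-- **THE LATTICE INTERIOR GRADIENT ESTIMATE (scalar)** — [Gilbarg–Trudinger Thm 3.9] on `ℤᵈ`: for `u : ℤᵈ → ℝ`, a site `x₀`, a direction `μ` and `R ≥ 1`, if
`|u x| ≤ U` and `|Σ_i ((u(x+e_i) − u x) − (u x − u(x−e_i)))| ≤ B` on the sup-cube `{|x_i − x₀,i| ≤ R}`, then `|u(x₀ + e_μ) − u(x₀)| ≤ 2·(d·U∕R + R·B)`.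
[folklore] -/
theorem abs_sub_le_of_laplacian (x₀ : Site d) (μ : Fin d) {R : ℕ} (hR : 1 ≤ R) (u : Site d → ℝ) {U B : ℝ}
    (hU : ∀ x : Site d, (∀ i, |x i - x₀ i| ≤ (R : ℤ)) → |u x| ≤ U)
    (hB : ∀ x : Site d, (∀ i, |x i - x₀ i| ≤ (R : ℤ)) → |∑ i, ((u (x + e i) - u x) - (u x - u (x - e i)))| ≤ B) :
    |u (x₀ + e μ) - u x₀| ≤ 2 * ((d : ℝ) * U / R + R * B) := by
  -- translate to the origin, for `u` and for `−u`
  have key : ∀ (s : ℝ), (s = 1 ∨ s = -1) → s * (u (x₀ + e μ) - u x₀) ≤ 2 * ((d : ℝ) * U / R + R * B) := by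
    intro s hs
    have hs2 : |s| = 1 := by rcases hs with rfl | rfl <;> simp
    set v : Site d → ℝ := fun y => s * u (y + x₀) with hv_def
    have hcube : ∀ y : Site d, (∀ i, |y i| ≤ (R : ℤ)) → ∀ i, |(y + x₀) i - x₀ i| ≤ (R : ℤ) := fun y hy i => by simpa using hy i
    have hU' : ∀ y : Site d, (∀ i, |y i| ≤ (R : ℤ)) → |v y| ≤ U := fun y hy => by
      rw [hv_def, abs_mul, hs2, one_mul]; exact hU _ (hcube y hy)
    have hB' : ∀ y : Site d, (∀ i, |y i| ≤ (R : ℤ)) → |∑ i, ((v (y + e i) - v y) - (v y - v (y - e i)))| ≤ B := by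
      intro y hy
      have h := hB (y + x₀) (hcube y hy)
      have heq : ∑ i, ((v (y + e i) - v y) - (v y - v (y - e i)))
          = s * ∑ i, ((u (y + x₀ + e i) - u (y + x₀)) - (u (y + x₀) - u (y + x₀ - e i))) := by
        rw [Finset.mul_sum]
        refine Finset.sum_congr rfl fun i _ => ?_
        have e1 : y + e i + x₀ = y + x₀ + e i := add_right_comm _ _ _
        have e2 : y - e i + x₀ = y + x₀ - e i := sub_add_eq_add_sub _ _ _
        simp only [hv_def, e1, e2]
        ring
      rw [heq, abs_mul, hs2, one_mul]
      exact h
    have h := sub_le_of_laplacian_zero μ hR v hU' hB'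
    have hv : v (e μ) - v 0 = s * (u (x₀ + e μ) - u x₀) := by simp only [hv_def, zero_add, add_comm (e μ) x₀]; ring
    linarith
  rw [abs_le]
  constructor
  · have := key (-1) (Or.inr rfl); linarith
  · have := key 1 (Or.inl rfl); linarith

/-! ## §2 The estimate for fields with values in a real normed space (Hahn–Banach) -/

/-- **THE LATTICE INTERIOR GRADIENT ESTIMATE IN A REAL NORMED SPACE**: for `u : ℤᵈ → E`, `‖u(x₀ + e_μ) − u(x₀)‖ ≤ 2·(d·U∕R + R·B)` whenever `‖u x‖ ≤ U` and
`‖Σ_i ((u(x+e_i) − u x) − (u x − u(x−e_i)))‖ ≤ B` on the sup-cube `{|x_i − x₀,i| ≤ R}`, `R ≥ 1` (scalar case on `g ∘ u` for a norming functional `g`). [folklore] -/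
theorem norm_sub_le_of_laplacian {E : Type*} [NormedAddCommGroup E] [NormedSpace ℝ E] (x₀ : Site d) (μ : Fin d) {R : ℕ} (hR : 1 ≤ R)
    (u : Site d → E) {U B : ℝ}
    (hU : ∀ x : Site d, (∀ i, |x i - x₀ i| ≤ (R : ℤ)) → ‖u x‖ ≤ U)
    (hB : ∀ x : Site d, (∀ i, |x i - x₀ i| ≤ (R : ℤ)) → ‖∑ i, ((u (x + e i) - u x) - (u x - u (x - e i)))‖ ≤ B) :
    ‖u (x₀ + e μ) - u x₀‖ ≤ 2 * ((d : ℝ) * U / R + R * B) := by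
  obtain ⟨g, hg1, hgv⟩ := exists_dual_vector'' ℝ (u (x₀ + e μ) - u x₀)
  have hgv' : g (u (x₀ + e μ) - u x₀) = ‖u (x₀ + e μ) - u x₀‖ := by simpa using hgv
  have hgle : ∀ w : E, |g w| ≤ ‖w‖ := fun w => by
    have h := g.le_opNorm w
    rw [Real.norm_eq_abs] at h
    exact h.trans (by nlinarith [norm_nonneg w])
  set f : Site d → ℝ := fun x => g (u x) with hf_def
  have hU' : ∀ x : Site d, (∀ i, |x i - x₀ i| ≤ (R : ℤ)) → |f x| ≤ U := fun x hx => (hgle _).trans (hU x hx)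
  have hB' : ∀ x : Site d, (∀ i, |x i - x₀ i| ≤ (R : ℤ)) → |∑ i, ((f (x + e i) - f x) - (f x - f (x - e i)))| ≤ B := by
    intro x hx
    have heq : ∑ i, ((f (x + e i) - f x) - (f x - f (x - e i))) = g (∑ i, ((u (x + e i) - u x) - (u x - u (x - e i)))) := by
      simp only [hf_def, map_sum, map_sub]
    rw [heq]
    exact (hgle _).trans (hB x hx)
  have h := abs_sub_le_of_laplacian x₀ μ hR f hU' hB'
  have hf : f (x₀ + e μ) - f x₀ = ‖u (x₀ + e μ) - u x₀‖ := by rw [← hgv', map_sub]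
  rw [← hf]
  exact (le_abs_self _).trans h

/-! ## §3 Block-mean-zero fields: forward differences and values controlled by the Laplacian, uniformly in block size and volume -/

/-- **LATTICE LIPSCHITZ BOUND FROM FORWARD DIFFERENCES**: if every forward difference of `u : ℤᵈ → E` has norm `≤ G`, then
`‖u (x + m) − u x‖ ≤ G · Σ_i |m_i|` for every lattice vector `m` (one axis by induction on the steps, then axis by axis). [folklore] -/
theorem lipschitz_of_forwardDiff {E : Type*} [SeminormedAddCommGroup E] (u : Site d → E) {G : ℝ}
    (hG : ∀ (x : Site d) (i : Fin d), ‖u (x + e i) - u x‖ ≤ G) (x m : Site d) :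
    ‖u (x + m) - u x‖ ≤ G * ∑ i, ((|m i| : ℤ) : ℝ) := by
  classical
  -- one axis, natural steps
  have hnat : ∀ (i : Fin d) (n : ℕ) (y : Site d), ‖u (y + (n : ℤ) • e i) - u y‖ ≤ G * n := by
    intro i n
    induction n with
    | zero => intro y; simp
    | succ n ih =>
        intro y
        have hstep : y + ((n + 1 : ℕ) : ℤ) • e i = (y + (n : ℤ) • e i) + e i := by
          rw [Nat.cast_succ, add_smul, one_smul, add_assoc]
        rw [hstep]
        calc ‖u (y + (n : ℤ) • e i + e i) - u y‖
            ≤ ‖u (y + (n : ℤ) • e i + e i) - u (y + (n : ℤ) • e i)‖ + ‖u (y + (n : ℤ) • e i) - u y‖ :=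
              norm_sub_le_norm_sub_add_norm_sub _ _ _
          _ ≤ G + G * n := add_le_add (hG _ i) (ih y)
          _ = G * ((n + 1 : ℕ) : ℝ) := by push_cast; ring
  -- one axis, integer steps
  have hint : ∀ (i : Fin d) (k : ℤ) (y : Site d), ‖u (y + k • e i) - u y‖ ≤ G * ((|k| : ℤ) : ℝ) := by
    intro i k y
    obtain ⟨n, rfl | rfl⟩ := Int.eq_nat_or_neg k
    · have h1 : ((|(n : ℤ)| : ℤ) : ℝ) = n := by simp
      rw [h1]; exact hnat i n y
    · have h1 : ((|(-(n : ℤ))| : ℤ) : ℝ) = n := by simp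
      rw [h1]
      have h2 := hnat i n (y + (-(n : ℤ)) • e i)
      rw [add_assoc, ← add_smul, neg_add_cancel, zero_smul, add_zero, norm_sub_rev] at h2
      exact h2
  -- all axes: peel one coordinate at a time
  have hS : ∀ (S : Finset (Fin d)) (y : Site d),
      ‖u (y + ∑ i ∈ S, m i • e i) - u y‖ ≤ G * ∑ i ∈ S, ((|m i| : ℤ) : ℝ) := by
    intro S
    induction S using Finset.induction_on with
    | empty => intro y; simp
    | insert j S hj ih =>
        intro y
        rw [Finset.sum_insert hj, Finset.sum_insert hj, ← add_assoc]
        calc ‖u (y + m j • e j + ∑ i ∈ S, m i • e i) - u y‖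
            ≤ ‖u (y + m j • e j + ∑ i ∈ S, m i • e i) - u (y + m j • e j)‖ + ‖u (y + m j • e j) - u y‖ :=
              norm_sub_le_norm_sub_add_norm_sub _ _ _
          _ ≤ G * ∑ i ∈ S, ((|m i| : ℤ) : ℝ) + G * ((|m j| : ℤ) : ℝ) := add_le_add (ih _) (hint j (m j) y)
          _ = G * (((|m j| : ℤ) : ℝ) + ∑ i ∈ S, ((|m i| : ℤ) : ℝ)) := by ring
  have hm : m = ∑ i, m i • e i := eq_sum_smul_e m
  calc ‖u (x + m) - u x‖ = ‖u (x + ∑ i, m i • e i) - u x‖ := by rw [← hm]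
    _ ≤ G * ∑ i, ((|m i| : ℤ) : ℝ) := hS Finset.univ x

/-- **SUP-REGULARITY OF THE LATTICE LAPLACIAN ON BLOCK-MEAN-ZERO FIELDS, UNIFORM IN THE BLOCK SIZE AND THE VOLUME**: let `d ≥ 1`, `M ≥ 1`, `N ≥ 1`,
and let `u : ℤᵈ → E` be `(N·M)`-periodic with vanishing sum over every `M`-block `M•z + [0,M)ᵈ`; if the lattice Laplacian satisfies
`‖Σ_i ((u(x+e_i) − u x) − (u x − u(x−e_i)))‖ ≤ B` everywhere, then `‖u(x + e_i) − u x‖ ≤ 16d²·M·B` and `‖u x‖ ≤ 16d³·M²·B` everywhere — the block means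
give `‖u‖_∞ ≤ dM·G` for the maximal forward difference `G`, and §2 at the maximising bond with `R = 4d²M` gives `G ≤ G∕2 + 8d²MB`. [folklore] -/
theorem supRegularity_of_blockMeanZero {E : Type*} [NormedAddCommGroup E] [NormedSpace ℝ E] (hd : 1 ≤ d) {M N : ℕ} (hM : 1 ≤ M) (hN : 1 ≤ N)
    (u : Site d → E) (hper : ∀ (x : Site d) (τ : Fin d), u (x + ((N * M : ℕ) : ℤ) • e τ) = u x)
    (hmean : ∀ z : Site d, ∑ v ∈ periodBox (d := d) M, u ((M : ℤ) • z + v) = 0)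
    {B : ℝ} (hB : ∀ x : Site d, ‖∑ i, ((u (x + e i) - u x) - (u x - u (x - e i)))‖ ≤ B) :
    (∀ (x : Site d) (i : Fin d), ‖u (x + e i) - u x‖ ≤ 16 * (d : ℝ) ^ 2 * M * B) ∧
      (∀ x : Site d, ‖u x‖ ≤ 16 * (d : ℝ) ^ 3 * (M : ℝ) ^ 2 * B) := by
  classical
  set P : ℕ := N * M with hP_def
  have hP : 1 ≤ P := Nat.mul_pos (by omega) (by omega)
  have hd0 : (0 : ℝ) < d := by exact_mod_cast hd
  have hM0 : (0 : ℝ) < M := by exact_mod_cast hM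
  -- the maximal forward difference over one period
  set S : Finset (Site d × Fin d) := (periodBox (d := d) P) ×ˢ (Finset.univ : Finset (Fin d)) with hS_def
  have hmemS : ∀ (x : Site d) (i : Fin d), (cmod P x, i) ∈ S := fun x i => by
    rw [hS_def, Finset.mem_product]
    exact ⟨(mem_periodBox).2 fun κ => ⟨cmod_nonneg hP x κ, cmod_lt hP x κ⟩, Finset.mem_univ _⟩
  have hSne : S.Nonempty := ⟨_, hmemS 0 ⟨0, hd⟩⟩
  obtain ⟨q₀, -, hq₀max⟩ := Finset.exists_max_image S (fun q => ‖u (q.1 + e q.2) - u q.1‖) hSne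
  set G : ℝ := ‖u (q₀.1 + e q₀.2) - u q₀.1‖ with hG_def
  have hG0 : 0 ≤ G := norm_nonneg _
  -- every forward difference is bounded by `G` (reduce to the period box by periodicity)
  have hGall : ∀ (x : Site d) (i : Fin d), ‖u (x + e i) - u x‖ ≤ G := by
    intro x i
    have hx : x = cmod P x + (P : ℤ) • cdiv P x := by rw [add_comm, smul_cdiv_add_cmod]
    have h1 : u x = u (cmod P x) := by
      have h := periodic_smul_vec hper (cmod P x) (cdiv P x)
      rwa [← hx] at h
    have hxe : x + e i = (cmod P x + e i) + (P : ℤ) • cdiv P x := by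
      have h : x + e i = (cmod P x + (P : ℤ) • cdiv P x) + e i := by rw [← hx]
      rw [h]; abel
    have h2 : u (x + e i) = u (cmod P x + e i) := by rw [hxe, periodic_smul_vec hper]
    rw [h1, h2]
    exact hq₀max _ (hmemS x i)
  -- the block means control the values: `‖u y‖ ≤ d·M·G`
  have hUall : ∀ y : Site d, ‖u y‖ ≤ (d : ℝ) * M * G := by
    intro y
    have hy : (M : ℤ) • cdiv M y + cmod M y = y := smul_cdiv_add_cmod M y
    have hcard : ((periodBox (d := d) M).card : ℝ) = (M : ℝ) ^ d := by rw [card_periodBox]; push_cast; ring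
    have hMd : (0 : ℝ) < (M : ℝ) ^ d := by positivity
    have hsum : ((M : ℝ) ^ d) • u y = ∑ v ∈ periodBox (d := d) M, (u y - u ((M : ℤ) • cdiv M y + v)) := by
      rw [Finset.sum_sub_distrib, hmean, sub_zero, Finset.sum_const, ← hcard, Nat.cast_smul_eq_nsmul]
    have hterm : ∀ v ∈ periodBox (d := d) M, ‖u y - u ((M : ℤ) • cdiv M y + v)‖ ≤ G * ((d : ℝ) * M) := by
      intro v hv
      have hv0 := (mem_periodBox).1 hv
      have h := lipschitz_of_forwardDiff u hGall ((M : ℤ) • cdiv M y + v) (cmod M y - v)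
      have heq : (M : ℤ) • cdiv M y + v + (cmod M y - v) = y := by rw [add_add_sub_cancel]; exact hy
      rw [heq] at h
      refine h.trans (mul_le_mul_of_nonneg_left ?_ hG0)
      calc ∑ i, ((|(cmod M y - v) i| : ℤ) : ℝ) ≤ ∑ _i : Fin d, (M : ℝ) := Finset.sum_le_sum fun i _ => by
              have h1 := hv0 i
              have h2 : 0 ≤ cmod M y i ∧ cmod M y i < M := ⟨cmod_nonneg hM y i, cmod_lt hM y i⟩
              have h3 : |(cmod M y - v) i| ≤ (M : ℤ) := by rw [Pi.sub_apply, abs_le]; constructor <;> omega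
              exact_mod_cast h3
        _ = (d : ℝ) * M := by simp
    have h1 : ‖((M : ℝ) ^ d) • u y‖ ≤ (M : ℝ) ^ d * (G * ((d : ℝ) * M)) := by
      rw [hsum]
      refine (norm_sum_le _ _).trans ?_
      calc ∑ v ∈ periodBox (d := d) M, ‖u y - u ((M : ℤ) • cdiv M y + v)‖
          ≤ ∑ _v ∈ periodBox (d := d) M, G * ((d : ℝ) * M) := Finset.sum_le_sum hterm
        _ = (M : ℝ) ^ d * (G * ((d : ℝ) * M)) := by rw [Finset.sum_const, nsmul_eq_mul, hcard]
    rw [norm_smul, Real.norm_of_nonneg hMd.le] at h1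
    have h2 := le_of_mul_le_mul_left h1 hMd
    linarith
  -- the gradient estimate at the maximising bond with `R = 4d²M`: `G ≤ G∕2 + 8d²MB`
  have hR : 1 ≤ 4 * d ^ 2 * M := Nat.mul_pos (Nat.mul_pos (by norm_num) (pow_pos (by omega) 2)) (by omega)
  have hkey := norm_sub_le_of_laplacian q₀.1 q₀.2 hR u (U := (d : ℝ) * M * G) (B := B) (fun x _ => hUall x) (fun x _ => hB x)
  have hRHS : 2 * ((d : ℝ) * ((d : ℝ) * M * G) / ((4 * d ^ 2 * M : ℕ) : ℝ) + ((4 * d ^ 2 * M : ℕ) : ℝ) * B)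
      = G / 2 + 8 * (d : ℝ) ^ 2 * M * B := by
    have hd0' : (d : ℝ) ≠ 0 := hd0.ne'
    have hM0' : (M : ℝ) ≠ 0 := hM0.ne'
    push_cast
    field_simp
    ring
  have hGle : G ≤ 16 * (d : ℝ) ^ 2 * M * B := by
    have h := hkey.trans (le_of_eq hRHS)
    linarith
  refine ⟨fun x i => (hGall x i).trans hGle, fun x => (hUall x).trans ?_⟩
  calc (d : ℝ) * M * G ≤ (d : ℝ) * M * (16 * (d : ℝ) ^ 2 * M * B) := mul_le_mul_of_nonneg_left hGle (by positivity)
    _ = 16 * (d : ℝ) ^ 3 * (M : ℝ) ^ 2 * B := by ring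

end

end Summit.QuantumFields.BalabanUV.T4Continuum.NE3DiscreteGradientEstimate
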